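import Mathlib
import Summits.NavierStokesRegularity.NavierStokesRegularity.Theorems.LerayQuarterDissipationFiniteDissipationLiouvilleCriticalProductionCredit
import Literature.Analysis.FluidPDE.TypeIAncientMildTimeAnalytic
import Literature.Analysis.FluidPDE.SpaceTimeCalculus
import HarnessLib

/-!
# Crux `FiniteDissipationLiouville` (stmt-NavierStokesRegularity-22144): THE BARE BORDERLINE `a = 1` OF THE
# CRITICAL-PRODUCTION ROW REDUCES TO CONSTANT-MODULUS VORTICITY PROFILES

Theorems file of route `LerayQuarterDissipation` (lead prover g19; `--supports` the crux; sequel of lead g18's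
`…CriticalProductionCredit` / `…CriticalProductionLaw`). Navier–Stokes regularity is NOT proved by anything here;
no summit is.

Lead g18: for `a < 1`, a KNSS-gauge Type-I field (`IsTypeIAncientMild C V`, no envelope, no law) with
`(−t)(⟪ω, DV ω⟫ − a|∇ω|²_F) ≤ |ω|²` everywhere vanishes (T55); at the BORDERLINE `a = 1` («`Q = t²|ω|²` is a
sub-solution of `∂ₜ + V·∇ − Δ`») the same holds UNDER THE LAW (T58), while in the bare class the extremals of the
hot-spot argument were recorded as «profiles with `|ω(t,·)| ≡ √M/(−t)`» and left open (census g18/g19). This file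
types that reduction and sharpens it by time analyticity:

* **`exists_constModulus_of_subsolution`** — if `V` in the bare class has `t²|ω|²` a sub-solution everywhere and
  is NOT irrotational, then there is a profile `W` IN THE SAME CLASS (`IsTypeIAncientMild C W`, a limit of
  translates/rescalings of `V`: enstrophy hot spot `…EnstrophyHotSpot.exists_enstrophy_hotSpot` + the parabolic
  strong maximum principle `…StrongMaxPrinciple.strongMaximumPrinciple`, both nsreg-p7) still satisfying the
  sub-solution property and with **`t²‖curl W(t,x)‖² = M > 0` at EVERY point of `(−∞, 0) × ℝ³`** — the strong
  maximum principle gives the slab `[−2,−1) × ℝ³`, and REAL-ANALYTICITY IN TIME of the class (Lemarié-Rieusset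
  Thm 9.12, Literature `IsTypeIAncientMild.analyticAt_uncurry`; here: `analyticAt_curl_time`,
  `analyticOnNhd_enstrophyDensity`) propagates the identity to all `t < 0`;
* **`subsolution_dichotomy`** — hence: `V ≡ 0`, OR such a constant-modulus profile exists in the class;
* **`borderline_identity_of_constModulus`** — on such a profile the borderline is ATTAINED IDENTICALLY:
  `(−t)(⟪ω, DW ω⟫ − |∇ω|²_F) = ‖ω‖²` everywhere (the exact balance `…weightedEnstrophy_identity` with `Q ≡ M`),
  so **`one_le_stretching_of_constModulus`**: the stretching rate along the vorticity is super-critical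
  EVERYWHERE, `‖ω‖² ≤ (−t)⟪ω, DW ω⟫`, and the vorticity vanishes NOWHERE;
* **`not_law_of_constModulus`** — such a profile violates every quarter-rate dissipation law (one slice has
  `|∇W|² ≥ ½|ω|² = M/(2t²)` everywhere, infinite integral) — re-deriving g18's T58 from the dichotomy.

So the bare borderline `a = 1` is EQUIVALENT to: «no KNSS-gauge Type-I ancient mild field has vorticity of
spatially constant modulus `√M/(−t)`, `M > 0`» — a field whose vorticity blows up at the Type-I rate at EVERY
point of the final slice, with everywhere super-critical stretching; parallel shear flows cannot do this (for
`W = (a(t,z), b(t,z), 0)` the modulus equation forces `1/(−t) = −|∂_zφ|²`), and nothing in the tree or in print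
excludes the general case (census).

HONEST FRAMING. A reduction (normal form) for an open sub-question about a HYPOTHETICAL class, not an exclusion;
it does not bear on the crux beyond T58 (which it re-derives) and removes nothing from the DSS wall
(`∀ c>1 TypeIDSSLiouville c`, NECESSARY for the crux). Nothing here bears on Navier–Stokes regularity.

References: Koch–Nadirashvili–Seregin–Šverák, Acta Math. 203 (2009) §4, Lemma 3.1; Lemarié-Rieusset 2016, Thm 9.12;
Nirenberg 1953 (strong maximum principle); folklore.
-/

noncomputable section

set_option linter.dupNamespace false

namespace Summit.NavierStokesRegularity.NavierStokesRegularity.Theorems.FiniteDissipationLiouville.CriticalProduction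

open MeasureTheory Set Function Filter Topology TopologicalSpace Metric InnerProductSpace
open scoped RealInnerProductSpace InnerProductSpace Laplacian ContDiff
open Literature.Analysis Literature.Analysis.FluidPDE
open Summit.NavierStokesRegularity.NavierStokesRegularity.Theorems
open Summit.NavierStokesRegularity.NavierStokesRegularity.Theorems.LocalSineTubeDoorProfileAlignedWindowRigidityAncient
open Summit.NavierStokesRegularity.NavierStokesRegularity.Theorems.PoloidalWindowDoorPoloidalWindowRigidityWindow
open Summit.NavierStokesRegularity.NavierStokesRegularity.Theorems.PoloidalWindowDoorPoloidalWindowRigidityDegenerate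
open Summit.NavierStokesRegularity.NavierStokesRegularity.Theorems.PoloidalWindowDoorPoloidalWindowRigidityFlat
open Summit.NavierStokesRegularity.NavierStokesRegularity.Theorems.PoloidalWindowDoorPoloidalWindowRigidityStrainRate
open Summit.NavierStokesRegularity.NavierStokesRegularity.Theorems.PoloidalWindowDoorPoloidalWindowRigidityPoloidalExtremal
open Summit.NavierStokesRegularity.NavierStokesRegularity.Theorems.PoloidalWindowDoorPoloidalWindowRigidityEnstrophyHotSpot
open Summit.NavierStokesRegularity.NavierStokesRegularity.Theorems.PoloidalWindowDoorPoloidalWindowRigidityStrongMaxPrinciple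
open Summit.NavierStokesRegularity.NavierStokesRegularity.Theorems.PoloidalWindowDoorPoloidalWindowRigidityVorticityTranslate
open Summit.NavierStokesRegularity.NavierStokesRegularity.Theorems.PoloidalWindowDoorPoloidalWindowRigidityCriticalProduction
open Summit.NavierStokesRegularity.NavierStokesRegularity.Theorems.FiniteDissipationLiouville.EndpointScheme

variable {C : ℝ} {V : ℝ → EuclideanSpace ℝ (Fin 3) → EuclideanSpace ℝ (Fin 3)}

/-! ### Time analyticity of the vorticity and of the enstrophy density -/

section Analytic

/-- **The vorticity of a member of the class is real-analytic in time at fixed `x`.** [cite: LemarieRieusset2016, Thm. 9.12 (PDF p. 260)] -/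
theorem analyticAt_curl_time {W : ℝ → EuclideanSpace ℝ (Fin 3) → EuclideanSpace ℝ (Fin 3)}
    (hW : IsTypeIAncientMild C W) {t : ℝ} (ht : t < 0) (x : EuclideanSpace ℝ (Fin 3)) :
    AnalyticAt ℝ (fun τ : ℝ => curl (W τ) x) t := by
  -- `curl (W τ) x = Ψ (D(uncurry W)(τ, x))` with the continuous linear `Ψ L = curlCLM (L ∘ inr)`
  set Ψ : (ℝ × EuclideanSpace ℝ (Fin 3) →L[ℝ] EuclideanSpace ℝ (Fin 3)) →L[ℝ] EuclideanSpace ℝ (Fin 3) :=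
    (curlCLM : (EuclideanSpace ℝ (Fin 3) →L[ℝ] EuclideanSpace ℝ (Fin 3)) →L[ℝ] EuclideanSpace ℝ (Fin 3)).comp
      ((ContinuousLinearMap.compL ℝ (EuclideanSpace ℝ (Fin 3)) (ℝ × EuclideanSpace ℝ (Fin 3))
        (EuclideanSpace ℝ (Fin 3))).flip (ContinuousLinearMap.inr ℝ ℝ (EuclideanSpace ℝ (Fin 3)))) with hΨ
  have hΨapply : ∀ L : ℝ × EuclideanSpace ℝ (Fin 3) →L[ℝ] EuclideanSpace ℝ (Fin 3),
      Ψ L = curlCLM (L.comp (ContinuousLinearMap.inr ℝ ℝ (EuclideanSpace ℝ (Fin 3)))) := by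
    intro L
    simp [hΨ]
  have hsm : IsSmoothSpaceTimeOn (Iio 0) W := hW.contDiffOn
  have hF : AnalyticAt ℝ (fderiv ℝ (uncurry W)) (t, x) := (hW.analyticAt_uncurry ht x).fderiv
  have hι : AnalyticAt ℝ (fun τ : ℝ => ((τ, x) : ℝ × EuclideanSpace ℝ (Fin 3))) t :=
    analyticAt_id.prod analyticAt_const
  have hFι : AnalyticAt ℝ (fun τ : ℝ => fderiv ℝ (uncurry W) (τ, x)) t := hF.comp_of_eq hι rfl
  have h1 : AnalyticAt ℝ (fun τ : ℝ => Ψ (fderiv ℝ (uncurry W) (τ, x))) t :=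
    (Ψ.analyticAt _).comp_of_eq hFι rfl
  refine h1.congr ?_
  filter_upwards [Iio_mem_nhds ht] with τ hτ
  rw [hΨapply, ← hsm.fderiv_slice_of_isOpen isOpen_Iio hτ x, ← curl_eq_curlCLM]

/-- **The enstrophy density `⟪ω, ω⟫(·, x)` is real-analytic in time.** [cite: LemarieRieusset2016, Thm. 9.12 (PDF p. 260)] -/
theorem analyticAt_enstrophyDensity_time {W : ℝ → EuclideanSpace ℝ (Fin 3) → EuclideanSpace ℝ (Fin 3)}
    (hW : IsTypeIAncientMild C W) {t : ℝ} (ht : t < 0) (x : EuclideanSpace ℝ (Fin 3)) :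
    AnalyticAt ℝ (fun τ : ℝ => ⟪curl (W τ) x, curl (W τ) x⟫_ℝ) t := by
  have h := analyticAt_curl_time hW ht x
  have hb := (innerSL ℝ (E := EuclideanSpace ℝ (Fin 3))).analyticAt_bilinear (curl (W t) x, curl (W t) x)
  have h2 : AnalyticAt ℝ (fun τ : ℝ => innerSL ℝ (curl (W τ) x) (curl (W τ) x)) t :=
    hb.comp_of_eq (h.prod h) rfl
  simpa only [innerSL_apply_apply] using h2

/-- `t ↦ t²⟪ω, ω⟫(t, x)` is real-analytic on `(−∞, 0)`. [cite: LemarieRieusset2016, Thm. 9.12 (PDF p. 260)] -/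
theorem analyticOnNhd_weightedEnstrophyDensity {W : ℝ → EuclideanSpace ℝ (Fin 3) → EuclideanSpace ℝ (Fin 3)}
    (hW : IsTypeIAncientMild C W) (x : EuclideanSpace ℝ (Fin 3)) :
    AnalyticOnNhd ℝ (fun τ : ℝ => τ ^ 2 * ⟪curl (W τ) x, curl (W τ) x⟫_ℝ) (Iio 0) :=
  fun _ ht => (analyticAt_id.pow 2).mul (analyticAt_enstrophyDensity_time hW ht x)

end Analytic

/-! ### The normal form -/

section NormalForm

/-- **THE NORMAL FORM OF THE BARE BORDERLINE.** A KNSS-gauge Type-I field (`IsTypeIAncientMild C V`, no envelope,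
no law) with `(−s)(⟪ω, DV ω⟫ − |∇ω|²_F) ≤ |ω|²` everywhere (`t²|ω|²` a sub-solution) which is NOT irrotational
yields a profile `W` of the same class with the same property and `t²‖curl W(t,x)‖² = M > 0` at EVERY point of
the open past. [enstrophy hot spot + strong maximum principle + time analyticity;
cite: KochNadirashviliSereginSverak2009, Prop. 4.1 and Lemma 3.1 (arXiv:0709.3599)] -/
theorem exists_constModulus_of_subsolution (hV : IsTypeIAncientMild C V)
    (hsub : ∀ s < 0, ∀ y, (-s) * (⟪curl (V s) y, fderiv ℝ (V s) y (curl (V s) y)⟫_ℝ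
        - frobeniusNormSq (fderiv ℝ (curl (V s)) y)) ≤ ⟪curl (V s) y, curl (V s) y⟫_ℝ)
    (hne : ∃ s₀ : ℝ, s₀ < 0 ∧ ∃ y₀, curl (V s₀) y₀ ≠ 0) :
    ∃ (W : ℝ → EuclideanSpace ℝ (Fin 3) → EuclideanSpace ℝ (Fin 3)) (M : ℝ),
      IsTypeIAncientMild C W ∧ 0 < M ∧
      (∀ s < 0, ∀ y, (-s) * (⟪curl (W s) y, fderiv ℝ (W s) y (curl (W s) y)⟫_ℝ
        - frobeniusNormSq (fderiv ℝ (curl (W s)) y)) ≤ ⟪curl (W s) y, curl (W s) y⟫_ℝ) ∧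
      ∀ t < 0, ∀ x, t ^ 2 * ⟪curl (W t) x, curl (W t) x⟫_ℝ = M := by
  -- adapted from `…CriticalProductionCredit.eq_zero_of_critical_production_credit` (lead g18) at `a = 1`
  obtain ⟨s₀, hs₀, y₀, hne⟩ := hne
  have hsub1 : ∀ s < 0, ∀ y, (-s) * (⟪curl (V s) y, fderiv ℝ (V s) y (curl (V s) y)⟫_ℝ
      - 1 * frobeniusNormSq (fderiv ℝ (curl (V s)) y)) ≤ ⟪curl (V s) y, curl (V s) y⟫_ℝ :=
    fun s hs y => by rw [one_mul]; exact hsub s hs y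
  -- ## the enstrophy hot spot inside the stratum
  obtain ⟨W, M, hW, hPW, hMpos, hle, hmax⟩ := exists_enstrophy_hotSpot
    (P := fun u => ∀ s < 0, ∀ y, (-s) * (⟪curl (u s) y, fderiv ℝ (u s) y (curl (u s) y)⟫_ℝ
        - 1 * frobeniusNormSq (fderiv ℝ (curl (u s)) y)) ≤ ⟪curl (u s) y, curl (u s) y⟫_ℝ)
    (fun u x₀ hu => critProdCredit_translate x₀ hu) (fun u c hc hu => critProdCredit_nsRescale hc hu)
    (fun w W' hw hPw _ hpt _ => critProdCredit_of_limit hw hPw hpt) hV hsub1 hs₀ hne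
  have hWrate : HasTypeITimeDecay C W := hW.hasTypeITimeDecay
  have hWcont : ContinuousOn (uncurry W) (Iio (0 : ℝ) ×ˢ univ) := hW.continuousOn_uncurry
  have hWmild : ∀ s t : ℝ, s < t → t < 0 → ∀ x,
      W t x = UnboundedOperators.heatExtension (W s) (t - s) x - oseenDuhamel 1 s W W t x :=
    fun s t hst ht x => hW.mild_eq_heatExtension hst ht x
  have hWdiv : ∀ t < 0, VectorCalculus.IsDivFree (W t) := fun t ht => hW.isDivFree ht
  -- ## `Q = t² |ω|²` is a sub-solution on the slab `[−2, −1/2] × ℝ³`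
  set q : ℝ → EuclideanSpace ℝ (Fin 3) → ℝ := fun τ y => ⟪curl (W τ) y, curl (W τ) y⟫_ℝ with hqdef
  set Q : ℝ → EuclideanSpace ℝ (Fin 3) → ℝ := fun τ y => τ ^ 2 * q τ y with hQdef
  set Qt : ℝ → EuclideanSpace ℝ (Fin 3) → ℝ := fun τ y => deriv (fun τ' => Q τ' y) τ with hQtdef
  have hg : ∀ τ < (0 : ℝ), HasDerivAt (fun τ : ℝ => τ ^ 2) (2 * τ) τ := fun τ _ => by
    simpa using hasDerivAt_pow 2 τ
  have hid := fun τ (hτ : τ < 0) y => weightedEnstrophy_identity hWrate hWcont hWmild hWdiv hg hτ y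
  have hslab : ∀ t ∈ Icc (-2 : ℝ) (-1 / 2), t < 0 := fun t ht => by linarith [ht.2]
  obtain ⟨B, hB⟩ := bdd_of_hasTypeITimeDecay hWrate (1 / 4) (by norm_num)
  have hbA : ∀ t ∈ Icc (-2 : ℝ) (-1 / 2), ∀ x, ‖W t x‖ ≤ B := fun t ht x => hB t (by linarith [ht.2]) x
  have hsmω : IsSmoothSpaceTimeOn (Iio 0) (vorticity W) :=
    (show IsSmoothSpaceTimeOn (Iio 0) W from hW.contDiffOn).isSmoothSpaceTimeOn_vorticity isOpen_Iio.uniqueDiffOn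
  have hq_c : ContinuousOn (uncurry q) (Icc (-2 : ℝ) (-1 / 2) ×ˢ univ) := by
    have hωc : ContinuousOn (uncurry (vorticity W)) (Icc (-2 : ℝ) (-1 / 2) ×ˢ univ) :=
      hsmω.continuousOn.mono (prod_mono (fun t ht => hslab t ht) Subset.rfl)
    have h : ContinuousOn (fun z => ⟪uncurry (vorticity W) z, uncurry (vorticity W) z⟫_ℝ)
        (Icc (-2 : ℝ) (-1 / 2) ×ˢ univ) := hωc.inner hωc
    refine h.congr fun z _ => ?_
    simp only [hqdef, uncurry, vorticity_apply]
  have hQ_c : ContinuousOn (uncurry Q) (Icc (-2 : ℝ) (-1 / 2) ×ˢ univ) := by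
    have hg1 : ContinuousOn (fun z : ℝ × EuclideanSpace ℝ (Fin 3) => z.1 ^ 2) (Icc (-2 : ℝ) (-1 / 2) ×ˢ univ) :=
      (continuous_fst.pow 2).continuousOn
    refine (hg1.mul hq_c).congr fun z _ => ?_
    rcases z with ⟨a, b⟩
    rfl
  have hq2 : ∀ t < (0 : ℝ), ContDiff ℝ 2 (q t) := fun t ht => by
    have hΩ : ContDiff ℝ 2 (curl (W t)) :=
      contDiff_curl (n := 2) (analyticOnNhd_slice hWcont (bdd_of_hasTypeITimeDecay hWrate) hWmild ht).contDiff
    exact hΩ.inner ℝ hΩ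
  have hQ2 : ∀ t ∈ Icc (-2 : ℝ) (-1 / 2), ContDiff ℝ 2 (Q t) := fun t ht => by
    have h : ContDiff ℝ 2 (fun y => t ^ 2 * q t y) := contDiff_const.mul (hq2 t (hslab t ht))
    exact h
  have hQt : ∀ x, ∀ t ∈ Icc (-2 : ℝ) (-1 / 2), HasDerivAt (fun τ => Q τ x) (Qt t x) t :=
    fun x t ht => (hid t (hslab t ht) x).1
  have hlaw0 : ∀ t ∈ Icc (-2 : ℝ) (-1 / 2), ∀ x,
      Qt t x + fderiv ℝ (Q t) x (W t x) - (Δ (Q t)) x ≤ 0 := by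
    intro t ht x
    have htn : t < 0 := hslab t ht
    have h := (hid t htn x).2
    have hP := hPW t htn x
    have h1 : t ^ 2 * ⟪curl (W t) x, fderiv ℝ (W t) x (curl (W t) x)⟫_ℝ
        - 1 * t ^ 2 * frobeniusNormSq (fderiv ℝ (curl (W t)) x) ≤ (-t) * q t x := by
      have h2 := mul_le_mul_of_nonneg_left hP (neg_pos.2 htn).le
      simp only [hqdef]
      nlinarith [h2]
    simp only [hQtdef, hQdef, hqdef] at h h1 ⊢
    rw [h]
    nlinarith [h1]
  have hle' : ∀ t ∈ Icc (-2 : ℝ) (-1 / 2), ∀ x, Q t x ≤ M := fun t ht x => by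
    have h := hle t (hslab t ht) x
    rw [neg_sq] at h
    exact h
  have hmaxQ : Q (-1) 0 = M := by
    simp only [hQdef, hqdef, hmax]
    norm_num
  have hts : (-1 : ℝ) ∈ Ioc (-2 : ℝ) (-1 / 2) := by constructor <;> norm_num
  -- ## the strong maximum principle: `Q ≡ M` on `[−2, −1) × ℝ³`
  have hS := strongMaximumPrinciple hbA hQ_c hQ2 hQt hlaw0 hle' hts hmaxQ
  -- ## time analyticity: `Q ≡ M` on the whole open past
  refine ⟨W, M, hW, hMpos, fun s hs y => by have := hPW s hs y; rwa [one_mul] at this, fun t ht x => ?_⟩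
  have han := analyticOnNhd_weightedEnstrophyDensity hW x
  have hconst : AnalyticOnNhd ℝ (fun _ : ℝ => M) (Iio 0) := fun _ _ => analyticAt_const
  have hz₀ : (-3 / 2 : ℝ) ∈ Iio (0 : ℝ) := by norm_num
  have hev : (fun τ : ℝ => τ ^ 2 * ⟪curl (W τ) x, curl (W τ) x⟫_ℝ) =ᶠ[𝓝 (-3 / 2 : ℝ)] fun _ => M := by
    filter_upwards [Ioo_mem_nhds (show (-2 : ℝ) < -3 / 2 by norm_num) (show (-3 / 2 : ℝ) < -1 by norm_num)]
      with τ hτ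
    exact hS τ ⟨hτ.1.le, hτ.2⟩ x
  exact han.eqOn_of_preconnected_of_eventuallyEq hconst isPreconnected_Iio hz₀ hev ht

/-- **THE DICHOTOMY.** A KNSS-gauge Type-I field with `t²|ω|²` a sub-solution everywhere either vanishes identically
or produces a constant-modulus-vorticity profile in the class. [cite: KochNadirashviliSereginSverak2009, Prop. 4.1 and Lemma 3.1 (arXiv:0709.3599)] -/
theorem subsolution_dichotomy (hV : IsTypeIAncientMild C V)
    (hsub : ∀ s < 0, ∀ y, (-s) * (⟪curl (V s) y, fderiv ℝ (V s) y (curl (V s) y)⟫_ℝ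
        - frobeniusNormSq (fderiv ℝ (curl (V s)) y)) ≤ ⟪curl (V s) y, curl (V s) y⟫_ℝ) :
    (∀ t < 0, ∀ x, V t x = 0) ∨
      ∃ (W : ℝ → EuclideanSpace ℝ (Fin 3) → EuclideanSpace ℝ (Fin 3)) (M : ℝ),
        IsTypeIAncientMild C W ∧ 0 < M ∧
        (∀ s < 0, ∀ y, (-s) * (⟪curl (W s) y, fderiv ℝ (W s) y (curl (W s) y)⟫_ℝ
          - frobeniusNormSq (fderiv ℝ (curl (W s)) y)) ≤ ⟪curl (W s) y, curl (W s) y⟫_ℝ) ∧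
        ∀ t < 0, ∀ x, t ^ 2 * ⟪curl (W t) x, curl (W t) x⟫_ℝ = M := by
  by_cases hirr : ∀ s < 0, ∀ y, curl (V s) y = 0
  · left
    exact eq_zero_of_irrotational hV.hasTypeITimeDecay hV.continuousOn_uncurry
      (fun _ _ hst ht x => hV.mild_eq_heatExtension hst ht x) (fun _ ht => hV.isDivFree ht) hirr
  · right
    push Not at hirr
    obtain ⟨s₀, hs₀, y₀, hne⟩ := hirr
    exact exists_constModulus_of_subsolution hV hsub ⟨s₀, hs₀, y₀, hne⟩

end NormalForm

/-! ### Consequences on a constant-modulus profile -/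

section Consequences

variable {W : ℝ → EuclideanSpace ℝ (Fin 3) → EuclideanSpace ℝ (Fin 3)} {M : ℝ}

/-- **On a constant-modulus profile the borderline is attained identically**: `(−t)(⟪ω, DW ω⟫ − |∇ω|²_F) = |ω|²`
at every point (the exact balance `∂ₜQ + W·∇Q − ΔQ = 2t|ω|² + 2t²(⟪ω, DW ω⟫ − |∇ω|²_F)` with `Q ≡ M`).
[cite: KochNadirashviliSereginSverak2009, Prop. 4.1 (arXiv:0709.3599)] -/
theorem borderline_identity_of_constModulus (hW : IsTypeIAncientMild C W)
    (hM : ∀ t < 0, ∀ x, t ^ 2 * ⟪curl (W t) x, curl (W t) x⟫_ℝ = M) :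
    ∀ t < 0, ∀ x, (-t) * (⟪curl (W t) x, fderiv ℝ (W t) x (curl (W t) x)⟫_ℝ
        - frobeniusNormSq (fderiv ℝ (curl (W t)) x)) = ⟪curl (W t) x, curl (W t) x⟫_ℝ := by
  intro t ht x
  have hWrate : HasTypeITimeDecay C W := hW.hasTypeITimeDecay
  have hWcont : ContinuousOn (uncurry W) (Iio (0 : ℝ) ×ˢ univ) := hW.continuousOn_uncurry
  have hWmild : ∀ s t : ℝ, s < t → t < 0 → ∀ x,
      W t x = UnboundedOperators.heatExtension (W s) (t - s) x - oseenDuhamel 1 s W W t x :=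
    fun s t hst ht x => hW.mild_eq_heatExtension hst ht x
  have hWdiv : ∀ t < 0, VectorCalculus.IsDivFree (W t) := fun t ht => hW.isDivFree ht
  have hg : ∀ τ < (0 : ℝ), HasDerivAt (fun τ : ℝ => τ ^ 2) (2 * τ) τ := fun τ _ => by
    simpa using hasDerivAt_pow 2 τ
  obtain ⟨-, hid⟩ := weightedEnstrophy_identity hWrate hWcont hWmild hWdiv hg ht x
  -- the slice `Q t` is the constant `M`, and `Q(·, x)` is constant near `t`
  have hslice : (fun y => t ^ 2 * ⟪curl (W t) y, curl (W t) y⟫_ℝ) = fun _ => M := funext fun y => hM t ht y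
  have hD : fderiv ℝ (fun y => t ^ 2 * ⟪curl (W t) y, curl (W t) y⟫_ℝ) x (W t x) = 0 := by
    rw [hslice]; simp
  have hL : (Δ (fun y => t ^ 2 * ⟪curl (W t) y, curl (W t) y⟫_ℝ)) x = 0 := by
    rw [hslice, laplacian_const]; simp
  have hev : (fun τ => τ ^ 2 * ⟪curl (W τ) x, curl (W τ) x⟫_ℝ) =ᶠ[𝓝 t] fun _ => M := by
    filter_upwards [Iio_mem_nhds ht] with τ hτ
    exact hM τ hτ x
  have hT : deriv (fun τ => τ ^ 2 * ⟪curl (W τ) x, curl (W τ) x⟫_ℝ) t = 0 := by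
    rw [hev.deriv_eq]; simp
  rw [hT, hD, hL] at hid
  simp only [add_zero, sub_zero] at hid
  -- `0 = 2t|ω|² + t²(2P − 2F)`, divide by `2t ≠ 0`
  have ht0 : t ≠ 0 := ht.ne
  have h1 : t * ((-t) * (⟪curl (W t) x, fderiv ℝ (W t) x (curl (W t) x)⟫_ℝ
      - frobeniusNormSq (fderiv ℝ (curl (W t)) x)) - ⟪curl (W t) x, curl (W t) x⟫_ℝ) = 0 := by
    nlinarith [hid]
  have h2 := (mul_eq_zero.1 h1).resolve_left ht0
  linarith

/-- **Everywhere super-critical stretching along the vorticity**: on a constant-modulus profile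
`|ω|² ≤ (−t)⟪ω, DW ω⟫` at every point (and `|ω|² = M/t² > 0`, so the rate `(−t)⟪ξ, DW ξ⟩ ≥ 1` everywhere).
[cite: KochNadirashviliSereginSverak2009, Prop. 4.1 (arXiv:0709.3599)] -/
theorem one_le_stretching_of_constModulus (hW : IsTypeIAncientMild C W)
    (hM : ∀ t < 0, ∀ x, t ^ 2 * ⟪curl (W t) x, curl (W t) x⟫_ℝ = M) :
    ∀ t < 0, ∀ x, ⟪curl (W t) x, curl (W t) x⟫_ℝ ≤
      (-t) * ⟪curl (W t) x, fderiv ℝ (W t) x (curl (W t) x)⟫_ℝ := by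
  intro t ht x
  have h := borderline_identity_of_constModulus hW hM t ht x
  have hF : 0 ≤ frobeniusNormSq (fderiv ℝ (curl (W t)) x) := frobeniusNormSq_nonneg _
  nlinarith [neg_pos.2 ht]

/-- **The vorticity of a constant-modulus profile vanishes nowhere and blows up at the Type-I rate at EVERY point of
the final slice**: `‖curl W(t,x)‖² = M/t²`. [folklore] -/
theorem norm_curl_sq_of_constModulus (hM : ∀ t < 0, ∀ x, t ^ 2 * ⟪curl (W t) x, curl (W t) x⟫_ℝ = M) :
    ∀ t < 0, ∀ x, ‖curl (W t) x‖ ^ 2 = M / t ^ 2 := by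
  intro t ht x
  have h := hM t ht x
  rw [real_inner_self_eq_norm_sq] at h
  have ht2 : 0 < t ^ 2 := by rw [← neg_sq]; exact pow_pos (neg_pos.2 ht) 2
  rw [eq_div_iff ht2.ne', mul_comm]
  exact h

/-- **A constant-modulus profile violates every quarter-rate dissipation law** (`|∇W|² ≥ ½‖ω‖² = M/(2t²)` on a
whole slice has infinite integral) — the dichotomy re-derives lead g18's T58 (`…CriticalProductionLaw`).
[folklore] -/
theorem not_law_of_constModulus (hMpos : 0 < M)
    (hM : ∀ t < 0, ∀ x, t ^ 2 * ⟪curl (W t) x, curl (W t) x⟫_ℝ = M) (K : ℝ) :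
    ¬ (∀ s : ℝ, s < 0 → ∫⁻ x, ‖fderiv ℝ (W s) x‖ₑ ^ 2 ≤ ENNReal.ofReal (K / Real.sqrt (-s))) := by
  intro hlaw
  have h1 := hlaw (-1) (by norm_num)
  have hc : ∀ x, ‖curl (W (-1)) x‖ ^ 2 = M := fun x => by
    rw [norm_curl_sq_of_constModulus hM (-1) (by norm_num) x]; norm_num
  -- `‖curl v‖ ≤ ‖curlCLM‖ ‖∇v‖`, and `‖curlCLM‖ > 0` since the vorticity is non-zero
  have hcurl : ∀ x, ‖curl (W (-1)) x‖ ≤ ‖curlCLM‖ * ‖fderiv ℝ (W (-1)) x‖ := fun x => by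
    rw [curl_eq_curlCLM]; exact curlCLM.le_opNorm _
  have hc0 : 0 < ‖curlCLM‖ := by
    rcases (norm_nonneg curlCLM).eq_or_lt with h0 | h0
    · exfalso
      have h2 := hcurl 0
      rw [← h0, zero_mul] at h2
      have h3 : ‖curl (W (-1)) 0‖ = 0 := le_antisymm h2 (norm_nonneg _)
      have h4 := hc 0
      rw [h3] at h4
      simp at h4
      exact hMpos.ne' h4.symm
    · exact h0
  set m : ℝ := M / ‖curlCLM‖ ^ 2 with hm
  have hmpos : 0 < m := by positivity
  have hpt : ∀ x : EuclideanSpace ℝ (Fin 3), ENNReal.ofReal m ≤ ‖fderiv ℝ (W (-1)) x‖ₑ ^ 2 := by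
    intro x
    have h2 : m ≤ ‖fderiv ℝ (W (-1)) x‖ ^ 2 := by
      rw [hm, div_le_iff₀ (by positivity)]
      have h3 := hcurl x
      have h4 := hc x
      nlinarith [norm_nonneg (curl (W (-1)) x), norm_nonneg (fderiv ℝ (W (-1)) x),
        mul_self_le_mul_self (norm_nonneg _) h3]
    calc ENNReal.ofReal m ≤ ENNReal.ofReal (‖fderiv ℝ (W (-1)) x‖ ^ 2) := ENNReal.ofReal_le_ofReal h2
      _ = ‖fderiv ℝ (W (-1)) x‖ₑ ^ 2 := by
          rw [← ofReal_norm, ENNReal.ofReal_pow (norm_nonneg _)]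
  have hinf : ∫⁻ x : EuclideanSpace ℝ (Fin 3), ‖fderiv ℝ (W (-1)) x‖ₑ ^ 2 = ⊤ := by
    refine eq_top_iff.2 ?_
    have hconst : ∫⁻ _ : EuclideanSpace ℝ (Fin 3), ENNReal.ofReal m = ⊤ := by
      rw [lintegral_const]
      simp [ENNReal.ofReal_eq_zero, not_le.2 hmpos]
    rw [← hconst]
    exact lintegral_mono hpt
  rw [hinf] at h1
  exact absurd h1 (not_le.2 ENNReal.ofReal_lt_top)

end Consequences

end Summit.NavierStokesRegularity.NavierStokesRegularity.Theorems.FiniteDissipationLiouville.CriticalProduction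

end
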